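import Mathlib
import HarnessLib
import Literature.Analysis.FluidPDE.Tao2016AveragedNS.RestartedCascadeFlows
import Summits.NavierStokesRegularity.NavierStokesRegularity.Theses.CompletionRelayChain

/-!
# `CompletionRelayChain` — crux `RelayFrontStep` (item stmt-NavierStokesRegularity-24850):
  THE IDLE MODE along restarted pseudo-flows (helper for LINE `window_v2`, stub `stub_idle`)

The completion-relay rows give mode `3` the ZERO row (`quadTerm 1 α X 3 n t = 0`). Along a restarted
pseudo-flow `TaoCascade.PseudoFlowOn τ ε₀ α κ₁ κ₂ S₀ F₀ B₀ S F` the local energy inequality (4.9),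
`∂ₛF ≤ quadTerm(S)·S`, carries NO defect term, so for a mode with the zero row the energies are
non-increasing on `[0, τ]` whatever the defect constants `κ₁, κ₂` and the slack `B₀`
(`idle_energy_antitoneOn`, `idle_energy_le_init`). Consequently an idle-mode ENERGY clause
`F 3 k ≤ e k` of a transition description re-enters after one checkpoint step with ANY amplitude
ratio `a` with `a² ≥ 1/2` as soon as the profile at least halves per shell, `e (1+k) ≤ e k / 2`
(`idle_clause_reenters`), and it propagates under any epoch envelope dominating `e`
(`idle_le_envelope`). This is why the repaired window `W₂` of LINE `window_v2`
(`Cruxes/RelayFrontStep/Lines/window_v2.lean`, census `Cruxes/RelayFrontStep/REPAIR-CENSUS-crc-p1.md`)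
states the idle clause on ENERGIES: an amplitude clause would be beaten by the admissible phantom
energy `B₀ ≤ η · slackWeight` far ahead of the front (census D1), an energy clause books it at time 0.

All statements are generic in the table (hypothesis: the zero row of one mode `j`), in the scale
ratio and in the defect constants; no definitions. HONEST FRAMING: elementary facts about MODEL
lattice pseudo-flows (Tao 2016 §4 (4.9)); helper for the crux, no stub credit by name (the registered
stub `stub_idle` of `window_v2` is their specialisation and is proved there from them); nothing here
is a statement about the Navier–Stokes equations; no summit, rung or crux is proved.
-/

noncomputable section

-- the summit-side namespace `Summit.NavierStokesRegularity.NavierStokesRegularity.…` (single-conjunct summit,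
-- D-0017) repeats a component by design; the dupNamespace linter would flag every declaration.
set_option linter.dupNamespace false

open Set Literature.Analysis.FluidPDE Literature.Analysis.FluidPDE.TaoCascade

namespace Summit.NavierStokesRegularity.NavierStokesRegularity.Theorems

namespace RelayFrontStep

variable {m : ℕ} {τ ε₀ κ₁ κ₂ : ℝ} {α : Fin m → Fin m → Fin m → ℤ × ℤ × ℤ → ℝ}
  {S₀ F₀ B₀ : Fin m → ℤ → ℝ} {S F : Fin m → ℤ → ℝ → ℝ}

/-- **A mode with the zero row has non-increasing energies along every pseudo-flow.** If
`quadTerm ε₀ α X j n t = 0` identically, then for every shell `k` the energy `F j k` is antitone on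
`[0, τ]` ((4.9) has no defect term). [cite: Tao2016AveragedNS, §4 Lemma 4.1 (4.9)] -/
theorem idle_energy_antitoneOn (h : PseudoFlowOn τ ε₀ α κ₁ κ₂ S₀ F₀ B₀ S F) (j : Fin m)
    (hj : ∀ (X : Fin m → ℤ → ℝ → ℝ) (n : ℤ) (t : ℝ), quadTerm ε₀ α X j n t = 0) (k : ℤ) :
    AntitoneOn (F j k) (Icc 0 τ) := by
  have hf := h.contDiffOn_F j k
  have hderiv : ∀ x ∈ interior (Icc (0 : ℝ) τ), deriv (F j k) x ≤ 0 := by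
    intro x hx
    rw [interior_Icc] at hx
    have hxI : Icc (0 : ℝ) τ ∈ nhds x := Icc_mem_nhds hx.1 hx.2
    have hle := h.energy j k x ⟨hx.1.le, hx.2.le⟩
    rwa [hj, zero_mul, derivWithin_of_mem_nhds hxI] at hle
  exact antitoneOn_of_deriv_nonpos (convex_Icc 0 τ) hf.continuousOn
    ((hf.differentiableOn one_ne_zero).mono interior_subset) hderiv

/-- **Energies of a zero-row mode stay below their start values**: `F j k s ≤ F₀ j k` on `[0, τ]`.
[cite: Tao2016AveragedNS, §4 Lemma 4.1 (4.9)] -/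
theorem idle_energy_le_init (h : PseudoFlowOn τ ε₀ α κ₁ κ₂ S₀ F₀ B₀ S F) (hτ : 0 < τ) (j : Fin m)
    (hj : ∀ (X : Fin m → ℤ → ℝ → ℝ) (n : ℤ) (t : ℝ), quadTerm ε₀ α X j n t = 0) (k : ℤ)
    {s : ℝ} (hs : s ∈ Icc 0 τ) : F j k s ≤ F₀ j k := by
  have h0 : (0 : ℝ) ∈ Icc 0 τ := ⟨le_rfl, hτ.le⟩
  have := idle_energy_antitoneOn h j hj k h0 hs hs.1
  rwa [h.init_F j k] at this

/-- **An idle-mode energy clause propagates under any dominating envelope**: if `F₀ j k ≤ e k` and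
`e k ≤ env k` for all `k`, then `F j k s ≤ env k` on `[0, τ]`. [cite: Tao2016AveragedNS, §4 Lemma 4.1 (4.9)] -/
theorem idle_le_envelope (h : PseudoFlowOn τ ε₀ α κ₁ κ₂ S₀ F₀ B₀ S F) (hτ : 0 < τ) (j : Fin m)
    (hj : ∀ (X : Fin m → ℤ → ℝ → ℝ) (n : ℤ) (t : ℝ), quadTerm ε₀ α X j n t = 0)
    {e env : ℤ → ℝ} (he : ∀ k, F₀ j k ≤ e k) (henv : ∀ k, e k ≤ env k) :
    ∀ s ∈ Icc 0 τ, ∀ k : ℤ, F j k s ≤ env k := fun _s hs k =>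
  ((idle_energy_le_init h hτ j hj k hs).trans (he k)).trans (henv k)

/-- **An idle-mode energy clause RE-ENTERS after a checkpoint step**: if `F₀ j k ≤ e k` for all `k`,
the profile at least halves per shell (`e (1+k) ≤ e k / 2`, `e ≥ 0`), and the amplitude ratio has
`a² ≥ 1/2` (e.g. `a ≥ 2^{-1/2}`, the weakest ratio the restart bookkeeping allows), then at every time
`τ₁ ∈ [0, τ]` the rescaled level-1 energies satisfy `F j (1+k) τ₁ / a² ≤ e k`.
[cite: Tao2016AveragedNS, §4 Lemma 4.1 (4.9) with §6.4 (the rescaling `Ẽ_k := e_N⁻² E_{N+k}`)] -/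
theorem idle_clause_reenters (h : PseudoFlowOn τ ε₀ α κ₁ κ₂ S₀ F₀ B₀ S F) (hτ : 0 < τ) (j : Fin m)
    (hj : ∀ (X : Fin m → ℤ → ℝ → ℝ) (n : ℤ) (t : ℝ), quadTerm ε₀ α X j n t = 0)
    {e : ℤ → ℝ} (he : ∀ k, F₀ j k ≤ e k) (he0 : ∀ k, 0 ≤ e k) (hhalf : ∀ k, e (1 + k) ≤ e k / 2)
    {a : ℝ} (ha : 1 / 2 ≤ a ^ 2) {τ₁ : ℝ} (hτ₁ : τ₁ ∈ Icc 0 τ) (k : ℤ) :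
    F j (1 + k) τ₁ / a ^ 2 ≤ e k := by
  have hpos : 0 < a ^ 2 := lt_of_lt_of_le (by norm_num) ha
  rw [div_le_iff₀ hpos]
  have h1 := (idle_energy_le_init h hτ j hj (1 + k) hτ₁).trans (he (1 + k))
  have h2 := hhalf k
  have h3 := he0 k
  nlinarith

/-- **Specialisation to the completion-relay rows** (mode `3` idle, `ε₀ = 1`): along every pseudo-flow
of a table whose nonlinearity has the relay rows, the idle energies stay below their start values.
[this file] -/
theorem idle_energy_le_init_of_relayRows {α : Fin 4 → Fin 4 → Fin 4 → ℤ × ℤ × ℤ → ℝ}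
    {S₀ F₀ B₀ : Fin 4 → ℤ → ℝ} {S F : Fin 4 → ℤ → ℝ → ℝ}
    (hrows : (∀ (X : Fin 4 → ℤ → ℝ → ℝ) (n : ℤ) (t : ℝ), quadTerm 1 α X 0 n t =
        -((1 + 1 : ℝ) ^ ((5 : ℝ) * n / 2) * (X 1 n t * X 1 n t)) +
          (1 + 1 : ℝ) ^ ((5 : ℝ) * ((n : ℝ) - 1) / 2) * (X 1 (n - 1) t * X 1 (n - 1) t)) ∧
      (∀ (X : Fin 4 → ℤ → ℝ → ℝ) (n : ℤ) (t : ℝ), quadTerm 1 α X 1 n t =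
        (1 + 1 : ℝ) ^ ((5 : ℝ) * n / 2) * (X 0 n t * X 1 n t - X 1 n t * X 0 (n + 1) t) -
          (1 / 32 : ℝ) * ((1 + 1 : ℝ) ^ ((5 : ℝ) * n / 2) * (X 0 (n + 1) t * X 2 n t)) +
          (1 / 32 : ℝ) * ((1 + 1 : ℝ) ^ ((5 : ℝ) * ((n : ℝ) - 1) / 2) *
            (X 2 (n - 1) t * X 1 (n - 1) t))) ∧
      (∀ (X : Fin 4 → ℤ → ℝ → ℝ) (n : ℤ) (t : ℝ), quadTerm 1 α X 2 n t =
        (1 / 32 : ℝ) * ((1 + 1 : ℝ) ^ ((5 : ℝ) * n / 2) *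
          (X 0 (n + 1) t * X 1 n t - X 1 n t * X 1 (n + 1) t))) ∧
      (∀ (X : Fin 4 → ℤ → ℝ → ℝ) (n : ℤ) (t : ℝ), quadTerm 1 α X 3 n t = 0))
    (h : PseudoFlowOn τ 1 α κ₁ κ₂ S₀ F₀ B₀ S F) (hτ : 0 < τ) :
    ∀ s ∈ Icc 0 τ, ∀ k : ℤ, F 3 k s ≤ F₀ 3 k :=
  fun _s hs k => idle_energy_le_init h hτ 3 hrows.2.2.2 k hs

end RelayFrontStep

end Summit.NavierStokesRegularity.NavierStokesRegularity.Theorems
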